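import Mathlib
import Summits.Ventures.PercRepro2.Defs
import Summits.Ventures.PercRepro2.Graph
import Summits.Ventures.PercRepro2.HullDefs
import Summits.Ventures.PercRepro2.LocRows
import Summits.Ventures.PercRepro2.SwRow
import Summits.Ventures.PercRepro2.SwAllRow
import Summits.Ventures.PercRepro2.SwParallelDefs

/-!
# The parallel reduction of row 2′SW-ALL (blind cell PercRepro2, night-4 g5, 2026-08-24;
proofs/NIGHT4-BRIDGE.md §4)

Two parallel edges `e`, `e'` between `u ≠ v` (SwParallelDefs.lean).  By their colours `Q(G)` splits
into the same-colour part, which is `Q(G − e')`, and the mixed part, which is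
`Q(G / {u = v}) × {RB, BR}`.  The rigid permutations of `G − e'` and of the merged graph assemble
to a rigid permutation of `G`: on the same-colour part `e'` takes the colour of `e` in the image, on
the mixed part the pair is swapped (`swAll_parallel`).  The reduction keeps the uniform fibre.
-/

namespace Summit.Ventures.PercRepro2

namespace Parallel

open Hull LocRows

open scoped Classical

variable {V : Type*} {E : Type*}
variable {ends : E → Sym2 V} {u v : V} {e e' : E}

/-! ## The reduction -/

/-- A configuration of `G` from one of `G − e'`: `e'` takes the colour of `e`. -/
noncomputable def ofDel (hp : IsParallel ends u v e e') (η : Config (DelE e')) : Config E :=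
  fun f => if h : f = e' then η ⟨e, hp.ne⟩ else η ⟨f, h⟩

/-- The restriction of `ofDel`. -/
lemma delConfig_ofDel (hp : IsParallel ends u v e e') (η : Config (DelE e')) :
    delConfig (e' := e') (ofDel hp η) = η := by
  funext f; simp [delConfig, ofDel, f.2]

/-- `ofDel` at `e'`. -/
lemma ofDel_e' (hp : IsParallel ends u v e e') (η : Config (DelE e')) :
    ofDel hp η e' = η ⟨e, hp.ne⟩ := by simp [ofDel]

/-- `ofDel` at `e`. -/
lemma ofDel_e (hp : IsParallel ends u v e e') (η : Config (DelE e')) :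
    ofDel hp η e = η ⟨e, hp.ne⟩ := by simp [ofDel, hp.ne]

/-- A same-colour configuration is `ofDel` of its restriction. -/
lemma ofDel_delConfig (hp : IsParallel ends u v e e') {ζ : Config E} (hs : ζ e = ζ e') :
    ofDel hp (delConfig ζ) = ζ := by
  funext f
  by_cases h : f = e'
  · subst h; simp [ofDel, delConfig, hs]
  · simp [ofDel, delConfig, h]

/-- A configuration of `G` from one of the merged graph and the colours of `e`, `e'`. -/
noncomputable def ofMerge (e e' : E) (η : Config (MergeE e e')) (c₁ c₂ : Bool) : Config E :=
  fun f => if h₁ : f = e then c₁ else if h₂ : f = e' then c₂ else η ⟨f, h₁, h₂⟩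

/-- The merged restriction of `ofMerge`. -/
lemma mergeConfig_ofMerge (η : Config (MergeE e e')) (c₁ c₂ : Bool) :
    mergeConfig (e := e) (e' := e') (ofMerge e e' η c₁ c₂) = η := by
  funext f; simp [mergeConfig, ofMerge, f.2.1, f.2.2]

/-- `ofMerge` at `e`. -/
lemma ofMerge_e (η : Config (MergeE e e')) (c₁ c₂ : Bool) : ofMerge e e' η c₁ c₂ e = c₁ := by
  simp [ofMerge]

/-- `ofMerge` at `e'`. -/
lemma ofMerge_e' (hne : e ≠ e') (η : Config (MergeE e e')) (c₁ c₂ : Bool) :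
    ofMerge e e' η c₁ c₂ e' = c₂ := by simp [ofMerge, hne.symm]

/-- A configuration is `ofMerge` of its merged restriction and its colours of `e`, `e'`. -/
lemma ofMerge_mergeConfig (ζ : Config E) :
    ofMerge e e' (mergeConfig (e := e) (e' := e') ζ) (ζ e) (ζ e') = ζ := by
  funext f
  by_cases h₁ : f = e
  · subst h₁; simp [ofMerge]
  by_cases h₂ : f = e'
  · subst h₂; simp [ofMerge, h₁]
  · simp [ofMerge, h₁, h₂, mergeConfig]

variable [Fintype E] [DecidableEq E]

/-- **`Q` in the same-colour case**: `ζ ∈ Q(G)` iff its restriction lies in `Q(G − e')`. -/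
theorem mem_tgtU_same_iff (hp : IsParallel ends u v e e') {l h o : V} {ζ : Config E}
    (hs : ζ e = ζ e') :
    ζ ∈ tgtU ends l h {S : Set V | o ∈ S} ↔
      delConfig (e' := e') ζ ∈ tgtU (delEnds ends e') l h {S : Set V | o ∈ S} := by
  have hb : blue ζ e = blue ζ e' := by simp only [blue_apply, hs]
  simp only [tgtU, Finset.mem_filter, Finset.mem_univ, true_and, hull, Set.mem_union,
    Set.mem_setOf_eq, not_or]
  rw [← delConfig_blue, cluster_same_eq hp hs, cluster_same_eq hp hb]

/-- **`Q` in the mixed case**: `ζ ∈ Q(G)` iff its merged restriction lies in `Q` of the merged graph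
with the renamed marks. -/
theorem mem_tgtU_mixed_iff (hp : IsParallel ends u v e e') {l h o : V} {ζ : Config E}
    (hmix : ζ e ≠ ζ e') :
    ζ ∈ tgtU ends l h {S : Set V | o ∈ S} ↔
      mergeConfig (e := e) (e' := e') ζ ∈ tgtU (mergeEnds ends u v e e') (rename u v l) (rename u v h)
        {S : Set V | rename u v o ∈ S} := by
  have hr : ζ e = true ∨ ζ e' = true := by
    rcases h : ζ e with _ | _
    · right; rcases h' : ζ e' with _ | _
      · exact absurd (h.trans h'.symm) hmix
      · rfl
    · left; rfl
  have hb : blue ζ e = true ∨ blue ζ e' = true := by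
    simp only [blue_eq_true_iff]
    rcases h : ζ e with _ | _
    · left; rfl
    · right; rcases h' : ζ e' with _ | _
      · rfl
      · exact absurd (h.trans h'.symm) hmix
  simp only [tgtU, Finset.mem_filter, Finset.mem_univ, true_and, hull, Set.mem_union,
    Set.mem_setOf_eq, not_or]
  rw [← mergeConfig_blue, mem_cluster_mixed_iff hp hr l h, mem_cluster_mixed_iff hp hb l h,
    mem_cluster_mixed_iff hp hr l o, mem_cluster_mixed_iff hp hb l o]

/-- **The parallel reduction of row 2′SW-ALL**: the rigid row on `G − e'` and on the merged graph
(with the renamed marks) gives the rigid row on `G`. -/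
theorem swAll_parallel (hp : IsParallel ends u v e e') {l h o : V}
    (hdel : SwAll (delEnds ends e') l h o)
    (hmer : SwAll (mergeEnds ends u v e e') (rename u v l) (rename u v h) (rename u v o)) :
    SwAll ends l h o := by
  obtain ⟨fd, hfd, hmemd⟩ := hdel
  obtain ⟨fm, hfm, hmemm⟩ := hmer
  let Φ : {ζ // ζ ∈ tgtU ends l h {S : Set V | o ∈ S}} → Config E := fun x =>
    if hs : x.1 e = x.1 e' then ofDel hp (fd ⟨delConfig x.1, (mem_tgtU_same_iff hp hs).1 x.2⟩)
    else ofMerge e e' (fm ⟨mergeConfig x.1, (mem_tgtU_mixed_iff hp hs).1 x.2⟩) (x.1 e') (x.1 e)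
  refine ⟨Φ, ?_, ?_⟩
  · intro x y hxy
    by_cases hsx : x.1 e = x.1 e' <;> by_cases hsy : y.1 e = y.1 e'
    · simp only [Φ, dif_pos hsx, dif_pos hsy] at hxy
      have hres := congrArg (delConfig (e' := e')) hxy
      rw [delConfig_ofDel, delConfig_ofDel] at hres
      have h' := congrArg Subtype.val (hfd hres)
      simp only at h'
      apply Subtype.ext
      rw [← ofDel_delConfig hp hsx, ← ofDel_delConfig hp hsy, h']
    · exfalso
      simp only [Φ, dif_pos hsx, dif_neg hsy] at hxy
      have h1 := congrFun hxy e
      have h2 := congrFun hxy e'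
      rw [ofDel_e, ofMerge_e] at h1
      rw [ofDel_e', ofMerge_e' hp.ne] at h2
      exact hsy (h2.symm.trans h1)
    · exfalso
      simp only [Φ, dif_neg hsx, dif_pos hsy] at hxy
      have h1 := congrFun hxy e
      have h2 := congrFun hxy e'
      rw [ofDel_e, ofMerge_e] at h1
      rw [ofDel_e', ofMerge_e' hp.ne] at h2
      exact hsx (h1.trans h2.symm).symm
    · simp only [Φ, dif_neg hsx, dif_neg hsy] at hxy
      have hres := congrArg (mergeConfig (e := e) (e' := e')) hxy
      rw [mergeConfig_ofMerge, mergeConfig_ofMerge] at hres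
      have h' := congrArg Subtype.val (hfm hres)
      simp only at h'
      have h1 := congrFun hxy e
      have h2 := congrFun hxy e'
      rw [ofMerge_e, ofMerge_e] at h1
      rw [ofMerge_e' hp.ne, ofMerge_e' hp.ne] at h2
      apply Subtype.ext
      calc x.1 = ofMerge e e' (mergeConfig x.1) (x.1 e) (x.1 e') := (ofMerge_mergeConfig x.1).symm
        _ = ofMerge e e' (mergeConfig y.1) (y.1 e) (y.1 e') := by rw [h', h2, h1]
        _ = y.1 := ofMerge_mergeConfig y.1
  · intro x
    by_cases hs : x.1 e = x.1 e'
    · have hx' := (mem_tgtU_same_iff hp hs).1 x.2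
      obtain ⟨hmem, hflip⟩ := hmemd ⟨delConfig x.1, hx'⟩
      have hΦ : Φ x = ofDel hp (fd ⟨delConfig x.1, hx'⟩) := by simp only [Φ, dif_pos hs]
      rw [hΦ]
      have hsame : ofDel hp (fd ⟨delConfig x.1, hx'⟩) e = ofDel hp (fd ⟨delConfig x.1, hx'⟩) e' := by
        rw [ofDel_e, ofDel_e']
      refine ⟨?_, ?_⟩
      · rw [mem_tgtU_same_iff hp hsame, delConfig_ofDel]; exact hmem
      · intro f hf hred
        rw [cluster_same_eq hp hs] at hf
        by_cases hfe : f = e'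
        · -- `e'` red inside the cluster: so is `e`, which flips
          rw [hfe] at hf hred ⊢
          rw [ofDel_e']
          have hin : (⟨e, hp.ne⟩ : DelE e') ∈ within (delEnds ends e') (cluster (delEnds ends e') (delConfig x.1) h) := by
            obtain ⟨a, ha, b, hb, hends⟩ := hf
            exact ⟨a, ha, b, hb, by show ends e = s(a, b); rw [hp.ends_e, ← hp.ends_e']; exact hends⟩
          exact hflip ⟨e, hp.ne⟩ hin (by show x.1 e = true; rw [hs]; exact hred)
        · have hin : (⟨f, hfe⟩ : DelE e') ∈ within (delEnds ends e') (cluster (delEnds ends e') (delConfig x.1) h) := by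
            obtain ⟨a, ha, b, hb, hends⟩ := hf
            exact ⟨a, ha, b, hb, hends⟩
          have := hflip ⟨f, hfe⟩ hin (by show x.1 f = true; exact hred)
          show ofDel hp _ f = false
          simp only [ofDel, dif_neg hfe]
          exact this
    · have hx' := (mem_tgtU_mixed_iff hp hs).1 x.2
      obtain ⟨hmem, hflip⟩ := hmemm ⟨mergeConfig x.1, hx'⟩
      have hΦ : Φ x = ofMerge e e' (fm ⟨mergeConfig x.1, hx'⟩) (x.1 e') (x.1 e) := by
        simp only [Φ, dif_neg hs]
      rw [hΦ]
      have hmix' : ofMerge e e' (fm ⟨mergeConfig x.1, hx'⟩) (x.1 e') (x.1 e) e ≠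
          ofMerge e e' (fm ⟨mergeConfig x.1, hx'⟩) (x.1 e') (x.1 e) e' := by
        rw [ofMerge_e, ofMerge_e' hp.ne]; exact fun h => hs h.symm
      have hr : x.1 e = true ∨ x.1 e' = true := by
        rcases h : x.1 e with _ | _
        · right; rcases h' : x.1 e' with _ | _
          · exact absurd (h.trans h'.symm) hs
          · rfl
        · left; rfl
      refine ⟨?_, ?_⟩
      · rw [mem_tgtU_mixed_iff hp hmix', mergeConfig_ofMerge]; exact hmem
      · intro f hf hred
        by_cases h₁ : f = e
        · rw [h₁] at hred ⊢
          rw [ofMerge_e]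
          rcases h' : x.1 e' with _ | _
          · rfl
          · exact absurd (hred.trans h'.symm) hs
        by_cases h₂ : f = e'
        · rw [h₂] at hred ⊢
          rw [ofMerge_e' hp.ne]
          rcases h' : x.1 e with _ | _
          · rfl
          · exact absurd (h'.trans hred.symm) hs
        · obtain ⟨a, ha, b, hb, hends⟩ := hf
          have hin : (⟨f, h₁, h₂⟩ : MergeE e e') ∈ within (mergeEnds ends u v e e')
              (cluster (mergeEnds ends u v e e') (mergeConfig x.1) (rename u v h)) := by
            refine ⟨rename u v a, (mem_cluster_mixed_iff hp hr h a).1 ha, rename u v b,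
              (mem_cluster_mixed_iff hp hr h b).1 hb, ?_⟩
            show (ends f).map (rename u v) = _
            rw [hends, Sym2.map_mk]
          have := hflip ⟨f, h₁, h₂⟩ hin (by show x.1 f = true; exact hred)
          show ofMerge e e' _ _ _ f = false
          simp only [ofMerge, dif_neg h₁, dif_neg h₂]
          exact this

end Parallel

end Summit.Ventures.PercRepro2
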